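import Summits.QuantumFields.BalabanUV.Beta.GAN24.DressedLegEnvelope
import Summits.QuantumFields.BalabanUV.Beta.GAN24.StaircaseFaces

/-!
# `BalabanUV.Beta.GAN24.ContactGaugeStaircase` — binder row G-an2-4 / (CONV-C), the row owner's CONTACT-TERM ROUTE (`gen18/CT3-MECHANISM.md` v1.1 §(b)–(c)),
# CT-3c analysis: THE BOND GAUGE FUNCTION OF THE DRESSED COMPOSITE LEG IS A STAIRCASE SUM `λ_{μz} = Σ_{s ≤ k} G s ∘ blk (Lc^s)` WITH GEOMETRIC PER-SCALE
# ENVELOPES `|G s (blk (Lc^s) u)| ≤ α·Lc^s·e^{−κ₀‖quo N u − z‖∞}`, `α = 8·Lc·C·(Lc^{5(k+1)})⁻¹` — exactly the hypotheses `hψ ∕ hG₁` (and `a s ≤ α·Lc^s`) of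
# the owner's `StaircasePairing.abs_pairing_le_sum` ∕ `sum_weights_le_of_geometric`.

NOT IN PRINT; OUR BOOKKEEPING (G-an2-4 formalisation swarm, leaf prover `b2b-balaban-gan24-formalise-leaf-01`, gen 58; CT-3c under «MINE» l.31499 ∕ 31626 ∕ 31667;
plan `HOME/b2b-balaban-gan24-formalise-leaf-01/g58/CT3C-ANALYSIS-PLAN.md` §4; names PROVISIONAL).  HONEST FRAMING (cell contract, verbatim): «discharging `BetaPertH`
makes Bałaban's UV stability UNCONDITIONAL — a real constructive-QFT result; it is NOT the continuum limit and NOT the Clay problem.»  HONEST DEPENDENCY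
(verbatim): «continuum YM on T⁴ ⇐ BetaPertH ∧ nine spine estimates (0/9 proved); BetaPertH ⇐ (D1) ∧ (D4) ∧ CAP+tail; G-an2-4 gates asym, D1 and NE2/3/4.»

WHAT.  The gauge function of the source bond `(μ, z)` of the dressed composite leg (`ContactKernelCells` §1),
`λ_{μz} u = Psi ρ Lc m k (delta1 μ z) u − bmGaugeAt ρ (respStep (Lc^m) (Lc^(m+k+1)) μ z) Lc u`, is by leaf-03's `Psi_apply` a sum of `k + 1` pieces, the
`s`-th BLOCK-CONSTANT on the `Lc^s`-blocks: the `s = 0` piece is (minus) the level-`m` rooted block-mean gauge of the undressed column itself (an arbitrary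
function — `blk 1 = id`), the `s = i+1` piece is the transported rooted gauge of the intermediate column `respStep (Lc^(m+s)) (Lc^(m+k+1))` read at `blk (Lc^s) u`.
* §1 (generic `d`) **`gauge_eq_staircase`**: `λ_{μz} u = Σ_{s ∈ range (k+1)} G s (blk (Lc^s) u)` with the piece family written as ONE lambda
  `G s y = if s = 0 then −bmGaugeAt ρ (B μ z) Lc y else −((Lc^{(d+1)s})⁻¹)·bmGaugeAt ρ (legAct (respStep (Lc^(m+s)) (Lc^(m+k+1))) (delta1 μ z)) Lc y`.
* §2 (`d = 3`, in-block root; parametric in leaf-12's (N1) data `κ₀, C` exactly as leaf-01 g57's `DressedLegEnvelope`) **`abs_gaugePiece_le`**: for ALL `s ≤ k` and `u`,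
  `|G s (blk (Lc^s) u)| ≤ (8·Lc·C·(Lc^{5(k+1)})⁻¹·Lc^s)·e^{−κ₀‖quo (Lc^(k+1)) u − z‖∞}` — the per-term envelope inside g57's `Psi_single_envelope`, EXPORTED
  term by term (`bmGaugeAt_respStep_envelope` + nested labels), and the `s = 0` piece by the same lemma at `j = k`; **`exists_gauge_staircase`**: the
  packaged `∃ κ₀ > 0, C ≥ 0` form for ALL `m k μ z` (constants OUTSIDE every ∀), geometric letters `a s = α·Lc^s`, `α = 8·Lc·C·(Lc^{5(k+1)})⁻¹`.
[folklore] throughout: bookkeeping over leaf-03's `Psi_apply`, leaf-01 g57's `bmGaugeAt_respStep_envelope`, leaf-12's (N1), the owner's `StaircaseFaces.blk_one` BY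
NAME; 0 `def`, 0 cited facts, 0 `def … : Prop`, 0 sorry.  NO new estimate; discharges NOTHING of (hS, hSall) on (E); 0 wall binders; NEVER «G-an2-4 closed»;
NOT D1, NOT BetaPertH, NOT continuum, NOT Clay.
-/

noncomputable section

open Finset
open scoped BigOperators
open Literature.MathematicalPhysics.QuantumFieldTheory
open Literature.MathematicalPhysics.QuantumFieldTheory.LatticeForm (quo)
open Literature.MathematicalPhysics.QuantumFieldTheory.Balaban1983to89
open Literature.MathematicalPhysics.QuantumFieldTheory.Balaban1983to89.Beta
open B4ContourShift (supNorm supNorm_nonneg)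
open AffineAveraging (Form0 Form1 Site box toSite)
open AveragingContours (blk)
open KKTFluctuationKernel (delta1)
open BalabanCompositeJets (respStep)
open Summit.QuantumFields.BalabanUV.Beta.AxialProjectorBlockMean (bmGaugeAt)
open Summit.QuantumFields.BalabanUV.Beta.GAN24.RespStepBmDecompLegs (legAct)
open Summit.QuantumFields.BalabanUV.Beta.GAN24.RespStepBmDecompExact (blk_blk_pow)
open Summit.QuantumFields.BalabanUV.Beta.GAN24.RespStepBmDecompPsi (Psi Psi_apply)
open Summit.QuantumFields.BalabanUV.Beta.GAN24.RespStepDecay (exists_respStep_decay_and_grad)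
open Summit.QuantumFields.BalabanUV.Beta.GAN24.UndressedResponseUnits (inv_cast_pow_pow)
open Summit.QuantumFields.BalabanUV.Beta.GAN24.DressedLegEnvelope (blk_pow_blk_pow single_eq_delta1 legAct_delta1 bmGaugeAt_respStep_envelope)
open Summit.QuantumFields.BalabanUV.Beta.GAN24.StaircaseFaces (blk_one)

namespace Summit.QuantumFields.BalabanUV.Beta.GAN24.ContactGaugeStaircase

variable {d : ℕ} {Lc : ℕ} [NeZero Lc]

/-! ## §1 The staircase presentation of the bond gauge function (generic `d`) -/

/-- NOT IN PRINT; OUR BOOKKEEPING.  **THE BOND GAUGE FUNCTION IS A STAIRCASE SUM** (generic `d`, every root `ρ`, every `m k μ z u`):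
`Psi ρ Lc m k (delta1 μ z) u − bmGaugeAt ρ (respStep (Lc^m) (Lc^(m+k+1)) μ z) Lc u = Σ_{s < k+1} G s (blk (Lc^s) u)`,
`G s y = if s = 0 then −bmGaugeAt ρ (respStep … μ z) Lc y else −((Lc^{(d+1)s})⁻¹)·bmGaugeAt ρ (legAct (respStep (Lc^(m+s)) (Lc^(m+k+1))) (delta1 μ z)) Lc y`
(leaf-03's `Psi_apply`, `Finset.sum_range_succ'`, `blk 1 = id`). -/
theorem gauge_eq_staircase (ρ : Fin (d + 1) → ℤ) (m k : ℕ) (μ : Fin (d + 1)) (z u : Site (d + 1)) :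
    Psi ρ Lc m k (delta1 μ z) u - bmGaugeAt ρ (respStep (d := d) (Lc ^ m) (Lc ^ (m + k + 1)) μ z) Lc u
      = ∑ s ∈ Finset.range (k + 1),
          (fun (s : ℕ) (y : Site (d + 1)) =>
            if s = 0 then -bmGaugeAt ρ (respStep (d := d) (Lc ^ m) (Lc ^ (m + k + 1)) μ z) Lc y
            else -(((Lc : ℝ) ^ ((d + 1) * s))⁻¹ *
              bmGaugeAt ρ (legAct (respStep (d := d) (Lc ^ (m + s)) (Lc ^ (m + k + 1))) (delta1 μ z)) Lc y)) s (blk (Lc ^ s) u) := by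
  rw [Finset.sum_range_succ']
  simp only [Nat.succ_ne_zero, if_false, if_true, pow_zero, blk_one]
  rw [Psi_apply, ← Finset.sum_neg_distrib, sub_eq_add_neg]
  refine congrArg₂ (· + ·) (Finset.sum_congr rfl fun i _ => ?_) rfl
  rw [show m + (i + 1) = m + i + 1 by ring]

/-! ## §2 `d = 3`: geometric per-scale envelopes of the pieces -/

section Four

/-- NOT IN PRINT; OUR BOOKKEEPING.  **EVERY PIECE OF THE STAIRCASE KEEPS THE SOURCE-SCALE ENVELOPE WITH A GEOMETRIC LETTER** (`d = 3`, in-block root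
`ρ = toSite rr`; parametric in leaf-12's (N1) data `κ₀, C` as in g57's `DressedLegEnvelope`): for ALL `m k μ z`, all `s ≤ k` and all `u`,
`|G s (blk (Lc^s) u)| ≤ (8·Lc·C·(Lc^{5(k+1)})⁻¹·Lc^s)·e^{−κ₀‖quo (Lc^(k+1)) u − z‖∞}` (`G` the piece family of `gauge_eq_staircase`). -/
theorem abs_gaugePiece_le {κ₀ C : ℝ}
    (hN1 : ∀ (m k : ℕ) (μ : Fin (3 + 1)) (z : Site (3 + 1)) (l'' : Fin (3 + 1)) (w' : Site (3 + 1)),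
      |respStep (d := 3) (Lc ^ m) (Lc ^ (m + k + 1)) μ z l'' w'| ≤
        C * ((Lc : ℝ) ^ (5 * (k + 1)))⁻¹ * Real.exp (-(κ₀ * supNorm (quo (Lc ^ (k + 1)) w' - z))))
    {rr : Fin (3 + 1) → ℕ} (hrr : rr ∈ box (3 + 1) Lc) (m k : ℕ) (μ : Fin (3 + 1)) (z : Site (3 + 1)) {s : ℕ} (hs : s ≤ k) (u : Site (3 + 1)) :
    |(fun (s : ℕ) (y : Site (3 + 1)) =>
        if s = 0 then -bmGaugeAt (toSite rr) (respStep (d := 3) (Lc ^ m) (Lc ^ (m + k + 1)) μ z) Lc y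
        else -(((Lc : ℝ) ^ ((3 + 1) * s))⁻¹ *
          bmGaugeAt (toSite rr) (legAct (respStep (d := 3) (Lc ^ (m + s)) (Lc ^ (m + k + 1))) (delta1 μ z)) Lc y)) s (blk (Lc ^ s) u)|
      ≤ 8 * (Lc : ℝ) * C * ((Lc : ℝ) ^ (5 * (k + 1)))⁻¹ * (Lc : ℝ) ^ s * Real.exp (-(κ₀ * supNorm (quo (Lc ^ (k + 1)) u - z))) := by
  have hL0 : (0 : ℝ) < Lc := by exact_mod_cast Nat.pos_of_ne_zero (NeZero.ne Lc)
  -- the undressed member as the leg family acting on the `if`-datum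
  have hcol : ∀ (n M : ℕ), respStep (d := 3) (Lc ^ n) (Lc ^ M) μ z
      = legAct (respStep (d := 3) (Lc ^ n) (Lc ^ M)) (fun μ' y => if μ' = μ then (if y = z then (1 : ℝ) else 0) else 0) := by
    intro n M; funext κ w; rw [single_eq_delta1, legAct_delta1]
  rcases Nat.eq_zero_or_pos s with h0 | hpos
  · -- the `s = 0` piece: the rooted gauge of the column itself (`j = k` levels up)
    subst h0
    simp only [if_true, pow_zero, blk_one, abs_neg, mul_one]
    rw [hcol]
    have hg := bmGaugeAt_respStep_envelope (Lc := Lc) hN1 hrr m k (m + k + 1) rfl μ z u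
    have hlab : blk (Lc ^ k) (blk Lc u) = quo (Lc ^ (k + 1)) u := by
      have h1 := blk_pow_blk_pow Lc k 1 u
      rw [pow_one, Nat.add_comm 1 k] at h1
      rw [h1]; rfl
    rw [hlab] at hg
    exact hg
  · -- the `s = i + 1` piece: the transported rooted gauge of the intermediate column
    obtain ⟨i, rfl⟩ : ∃ i, s = i + 1 := ⟨s - 1, by omega⟩
    have hik : i < k := by omega
    simp only [Nat.succ_ne_zero, if_false, abs_neg]
    rw [← single_eq_delta1]
    have hg := bmGaugeAt_respStep_envelope (Lc := Lc) hN1 hrr (m + (i + 1)) (k - i - 1) (m + k + 1) (by omega) μ z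
      (blk (Lc ^ (i + 1)) u)
    have hlab : blk (Lc ^ (k - i - 1)) (blk Lc (blk (Lc ^ (i + 1)) u)) = quo (Lc ^ (k + 1)) u := by
      rw [blk_blk_pow, blk_pow_blk_pow, show i + 1 + 1 + (k - i - 1) = k + 1 by omega]
      rfl
    rw [hlab] at hg
    rw [abs_mul, abs_inv, abs_pow, abs_of_pos hL0]
    calc ((Lc : ℝ) ^ ((3 + 1) * (i + 1)))⁻¹ * |bmGaugeAt (toSite rr)
            (legAct (respStep (d := 3) (Lc ^ (m + (i + 1))) (Lc ^ (m + k + 1)))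
              (fun μ' y => if μ' = μ then (if y = z then (1 : ℝ) else 0) else 0)) Lc (blk (Lc ^ (i + 1)) u)|
        ≤ ((Lc : ℝ) ^ ((3 + 1) * (i + 1)))⁻¹ *
            (8 * (Lc : ℝ) * C * ((Lc : ℝ) ^ (5 * (k - i - 1 + 1)))⁻¹ * Real.exp (-(κ₀ * supNorm (quo (Lc ^ (k + 1)) u - z)))) :=
          mul_le_mul_of_nonneg_left hg (by positivity)
      _ = 8 * (Lc : ℝ) * C * ((Lc : ℝ) ^ (5 * (k + 1)))⁻¹ * (Lc : ℝ) ^ (i + 1) * Real.exp (-(κ₀ * supNorm (quo (Lc ^ (k + 1)) u - z))) := by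
          have e : (Lc : ℝ) ^ (5 * (k + 1))
              = (Lc : ℝ) ^ ((3 + 1) * (i + 1)) * (Lc : ℝ) ^ (5 * (k - i - 1 + 1)) * (Lc : ℝ) ^ (i + 1) := by
            rw [← pow_add, ← pow_add]
            congr 1
            omega
          rw [e]
          field_simp

/-- NOT IN PRINT; OUR BOOKKEEPING.  **THE PACKAGED FORM** (`d = 3`, in-block root): leaf-12's (N1) rate `κ₀ > 0` and constant `C ≥ 0` with, for ALL `m k μ z`,
the staircase presentation of §1 AND the per-scale envelopes of §2 — the hypotheses `hψ` ∕ `hG₁` of the owner's `StaircasePairing.abs_pairing_le_sum` for the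
bond gauge function, with GEOMETRIC letters `a s = (8·Lc·C·(Lc^{5(k+1)})⁻¹)·Lc^s` (`sum_weights_le_of_geometric`'s `a s ≤ α·Lc^s` with equality). -/
theorem exists_gauge_staircase :
    ∃ κ₀ C : ℝ, 0 < κ₀ ∧ 0 ≤ C ∧ ∀ (rr : Fin (3 + 1) → ℕ), rr ∈ box (3 + 1) Lc →
      ∀ (m k : ℕ) (μ : Fin (3 + 1)) (z : Site (3 + 1)),
        (∀ u, Psi (toSite rr) Lc m k (delta1 μ z) u - bmGaugeAt (toSite rr) (respStep (d := 3) (Lc ^ m) (Lc ^ (m + k + 1)) μ z) Lc u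
          = ∑ s ∈ Finset.range (k + 1),
              (fun (s : ℕ) (y : Site (3 + 1)) =>
                if s = 0 then -bmGaugeAt (toSite rr) (respStep (d := 3) (Lc ^ m) (Lc ^ (m + k + 1)) μ z) Lc y
                else -(((Lc : ℝ) ^ ((3 + 1) * s))⁻¹ *
                  bmGaugeAt (toSite rr) (legAct (respStep (d := 3) (Lc ^ (m + s)) (Lc ^ (m + k + 1))) (delta1 μ z)) Lc y)) s (blk (Lc ^ s) u)) ∧
        (∀ s, s ≤ k → ∀ u,
          |(fun (s : ℕ) (y : Site (3 + 1)) =>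
              if s = 0 then -bmGaugeAt (toSite rr) (respStep (d := 3) (Lc ^ m) (Lc ^ (m + k + 1)) μ z) Lc y
              else -(((Lc : ℝ) ^ ((3 + 1) * s))⁻¹ *
                bmGaugeAt (toSite rr) (legAct (respStep (d := 3) (Lc ^ (m + s)) (Lc ^ (m + k + 1))) (delta1 μ z)) Lc y)) s (blk (Lc ^ s) u)|
            ≤ (8 * (Lc : ℝ) * C * ((Lc : ℝ) ^ (5 * (k + 1)))⁻¹ * (Lc : ℝ) ^ s) * Real.exp (-(κ₀ * supNorm (quo (Lc ^ (k + 1)) u - z)))) := by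
  obtain ⟨κ₀, C, -, hκ₀, hC, -, hN1', -⟩ := exists_respStep_decay_and_grad (Lc := Lc)
  have hN1 : ∀ (m k : ℕ) (μ : Fin (3 + 1)) (z : Site (3 + 1)) (l'' : Fin (3 + 1)) (w' : Site (3 + 1)),
      |respStep (d := 3) (Lc ^ m) (Lc ^ (m + k + 1)) μ z l'' w'| ≤
        C * ((Lc : ℝ) ^ (5 * (k + 1)))⁻¹ * Real.exp (-(κ₀ * supNorm (quo (Lc ^ (k + 1)) w' - z))) := by
    intro m k μ z l'' w'
    have h := hN1' m k μ z l'' w'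
    rwa [inv_cast_pow_pow] at h
  exact ⟨κ₀, C, hκ₀, hC, fun rr hrr m k μ z =>
    ⟨fun u => gauge_eq_staircase (toSite rr) m k μ z u, fun s hs u => abs_gaugePiece_le hN1 hrr m k μ z hs u⟩⟩

end Four

end Summit.QuantumFields.BalabanUV.Beta.GAN24.ContactGaugeStaircase

end
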